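import Summits.ResolutionOfSingularities.ResolutionOfSingularities.Theorems.FrobeniusClosingSteerSwitchingAssembly
import HarnessLib

/-!
# Crux `Steer`, line `switching-dichotomy`: the assembly under the PARAMETER-archimedean hypothesis

Lead reshape r4 of the line `switching-dichotomy` (crux `FrobeniusClosing.Steer`,
item `stmt-ResolutionOfSingularities-16345`). The landed assembly `stub_switchingAssembly`
(`FrobeniusClosingSteerSwitchingAssembly.lean`) uses archimedeanity of the valuation on `Frac A₀`
(rank one) at exactly one point: to find a power of a regular parameter `x` of some member `R i` of the
quadratic sequence with `v(x ^ n) < v(b)`, `b := t ^ p − g ^ p`. This file proves the same assembly under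
precisely that weaker hypothesis (`stub_switchingAssemblySeq`):

* **parameter-archimedean along the sequence**: for every non-zero fraction `y` of `A₀` of positive
  value there are a member `R i` of the quadratic sequence of `(A₀)_{centre}` along `O`, a one-element
  part `z` of a regular system of parameters of `R i`, and `n` with `v((z 0) ^ n) < v(y)`.

It holds in the rank-one case (`archSeq_of_arch`: take any member of a regular system of parameters of
`R 0`), but also for Granja's HEIGHT-ONE-DIRECTED sequences along an EXCEPTIONAL prime divisor `W`
(rank two, `Γ = ℤ ⊕ G`: some later exceptional parameter `z` has `w(z) > 0`, and then `n · w(z) > w(y)`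
for large `n`) — the standing disprover's inhabitant `ord_𝔪 ∘ (arc valuation)` of Disproof.lean §6 (d) —,
so the open along-a-prime stub of the line shrinks accordingly. The proof is that of
`stub_switchingAssembly` verbatim, with the regular parameter supplied by the hypothesis instead of
`exists_isRsopPart_one` + archimedeanity; the helpers of that file are reused.

Sources: W. Heinzer, K. A. Loper, B. Olberding, H. Schoutens, M. Toeniskoetter, *Ideal theory of
infinite directed unions of local quadratic transforms* [HeinzerEtAl2015], Prop. 4.4, Lemma 2.7,
Remark 2.4; A. Granja, *Valuations determined by quadratic transforms of a regular ring*, J. Algebra 280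
(2004).
-/

-- `Summit.<S>.<S>.…` duplicates the summit name by design (D-0017, single-problem summit).
set_option linter.dupNamespace false

open IsLocalRing
open Literature.AlgebraicGeometry.Resolution

namespace Summit.ResolutionOfSingularities.ResolutionOfSingularities.Theorems.SwitchingDichotomy

/-- **Rank one ⇒ parameter-archimedean along the sequence.** If the valuation of `O` is archimedean
on the fractions of `A₀` and `A₀` is regular at the centre, then every non-zero fraction `y` of
positive value is dominated by a power of any member of a regular system of parameters of
`R 0 = (A₀)_{centre}` (whose maximal ideal is non-zero because it contains the numerator of `y`).
[folklore] -/
theorem archSeq_of_arch {k K : Type} [Field k] [Field K] [Algebra k K] (O : ValuationSubring K)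
    (A₀ : Subalgebra k K) (h₀ : A₀.toSubring ≤ O.toSubring)
    (hreg : IsRegularLocalRing (Localization.AtPrime
      (Ideal.comap (Subring.inclusion h₀) (IsLocalRing.maximalIdeal O))))
    (hArch : ∀ x y : K, (∃ a ∈ A₀, ∃ b ∈ A₀, b ≠ 0 ∧ x = a / b) →
      (∃ a ∈ A₀, ∃ b ∈ A₀, b ≠ 0 ∧ y = a / b) → y ≠ 0 → O.valuation x < 1 →
      ∃ n : ℕ, O.valuation x ^ n < O.valuation y) :
    ∀ R : ℕ → Subring K, R 0 = locAtCentre A₀.toSubring O →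
      (∀ i, IsQuadraticTransformAlong O (R i) (R (i + 1))) →
      ∀ y : K, (∃ a ∈ A₀, ∃ b ∈ A₀, b ≠ 0 ∧ y = a / b) → y ≠ 0 → O.valuation y < 1 →
        ∃ (i : ℕ) (_ : IsLocalRing (R i)) (z : Fin 1 → R i), IsRsopPart z ∧
          ∃ n : ℕ, O.valuation ((z 0 : R i) : K) ^ n < O.valuation y := by
  intro R hR0 _ y hyfrac hy0 hvy
  classical
  -- `R 0` is a regular local ring dominated by `O`
  haveI hreg0 : IsRegularLocalRing (R 0) := by
    rw [hR0]; exact (isRegularLocalRing_locAtCentre_iff h₀).mpr hreg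
  have hdom0 : SubringDominates (R 0) O.toSubring := by
    rw [hR0]; exact subringDominates_locAtCentre h₀
  have hRO : R 0 ≤ O.toSubring := hdom0.1
  have hmax : ∀ a : R 0, a ∈ maximalIdeal (R 0) ↔ O.valuation (a : K) < 1 :=
    (subringDominates_valuationSubring_iff hRO).mp hdom0
  have hA₀R : ∀ x ∈ A₀, x ∈ R 0 := fun x hx => by
    rw [hR0]; exact le_locAtCentre A₀.toSubring O hx
  -- the numerator of `y` is a non-zero element of the maximal ideal of `R 0`
  obtain ⟨a, haA, b, hbA, hb0, rfl⟩ := hyfrac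
  have ha0 : a ≠ 0 := by
    rintro rfl
    exact hy0 (zero_div b)
  have hva : O.valuation a < 1 := by
    have ha : a = a / b * b := by rw [div_mul_cancel₀ _ hb0]
    rw [ha, map_mul]
    calc O.valuation (a / b) * O.valuation b ≤ O.valuation (a / b) * 1 :=
          mul_le_mul_right ((O.valuation_le_one_iff _).mpr (h₀ hbA)) _
      _ < 1 := by rw [mul_one]; exact hvy
  have hne : maximalIdeal (R 0) ≠ ⊥ := by
    intro hbot
    have ham : (⟨a, hA₀R a haA⟩ : R 0) ∈ maximalIdeal (R 0) := (hmax _).mpr hva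
    rw [hbot, Ideal.mem_bot] at ham
    exact ha0 (congrArg Subtype.val ham)
  obtain ⟨z, hz⟩ := exists_isRsopPart_one hne
  have hvz : O.valuation ((z 0 : R 0) : K) < 1 := (hmax _).mp (hz.mem_maximalIdeal 0)
  -- members of `R 0` are fractions of elements of `A₀`
  have hzfrac : ∃ a' ∈ A₀, ∃ b' ∈ A₀, b' ≠ 0 ∧ ((z 0 : R 0) : K) = a' / b' := by
    have hz0 : ((z 0 : R 0) : K) ∈ locAtCentre A₀.toSubring O := by rw [← hR0]; exact (z 0).2
    obtain ⟨a', ha', b', hb', hvb', h⟩ := (mem_locAtCentre_iff).mp hz0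
    exact ⟨a', ha', b', hb', ne_zero_of_valuation_eq_one hvb', h⟩
  obtain ⟨n, hn⟩ := hArch _ _ hzfrac ⟨a, haA, b, hbA, hb0, rfl⟩ hy0 hvz
  exact ⟨0, inferInstance, z, hz, n, hn⟩

/-- **Strongly switching + parameter-archimedean + defectless ⇒ torsor LU, from the three worker
stubs** (`stub_rsopMonomialStep`, `stub_switchingSetup`, `stub_switchingExit`, taken as hypotheses with
their statements verbatim). As `stub_switchingAssembly`, except that the regular parameter `x` with
`v(x ^ n) < v(t ^ p − g ^ p)` is supplied, at some stage `R i₁` of the sequence, by the hypothesis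
(parameter-archimedean along the sequence) instead of rank one: then `xⁿ / b ∈ O ∩ Frac A₀` lies in some
`R N` (strong switching), `b ∣ xⁿ` there, `xⁿ` and hence `b` is a monomial in a part of a regular system
of parameters of `R N` times a unit (iterating the one-step lemma; divisors of products of prime powers),
some exponent is prime to `p` by defectlessness, and the exit stub concludes.
[cite: HeinzerEtAl2015, Prop. 4.4 and Remark 2.4] [folklore] -/
theorem stub_switchingAssemblySeq
    (h₁ : ∀ (K : Type) [Field K] (O : ValuationSubring K) (R R₁ : Subring K) [IsLocalRing R]
      [IsLocalRing R₁], SubringDominates R O.toSubring → IsQuadraticTransformAlong O R R₁ →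
      ∀ (s : ℕ) (z : Fin s → R), IsRsopPart z →
      ∃ (s₁ : ℕ) (z₁ : Fin s₁ → R₁), IsRsopPart z₁ ∧
        ∀ j : Fin s, ∃ (e : Fin s₁ → ℕ) (u : R₁), IsUnit u ∧
          ((z j : R) : K) = (∏ l, ((z₁ l : R₁) : K) ^ e l) * (u : K))
    (h₂ : ∀ (k K : Type) [Field k] [Field K] [Algebra k K] (O : ValuationSubring K)
      (A₀ : Subalgebra k K) (h₀ : A₀.toSubring ≤ O.toSubring),
      IsRegularLocalRing (Localization.AtPrime
        (Ideal.comap (Subring.inclusion h₀) (IsLocalRing.maximalIdeal O))) →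
      (∃ a ∈ A₀, a ≠ 0 ∧ O.valuation a < 1) →
      ∃ R : ℕ → Subring K, R 0 = locAtCentre A₀.toSubring O ∧
        (∀ i, IsQuadraticTransformAlong O (R i) (R (i + 1))) ∧ (∀ i, IsRegularLocalRing (R i)) ∧
        (∀ i, SubringDominates (R i) O.toSubring) ∧
        ∀ i, ∀ x ∈ R i, ∃ y ∈ A₀, ∃ z ∈ A₀, z ≠ 0 ∧ x = y / z)
    (h₃ : ∀ p : ℕ, p.Prime → ∀ (k K : Type) [Field k] [CharP k p] [Field K] [Algebra k K]
      (O : ValuationSubring K) (A₀ : Subalgebra k K) (h₀ : A₀.toSubring ≤ O.toSubring) (t : K),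
      A₀.FG → t ^ p ∈ A₀ → IsFractionRing (Algebra.adjoin k (insert t (A₀ : Set K))) K →
      ∀ (R : ℕ → Subring K), R 0 = locAtCentre A₀.toSubring O →
      (∀ i, IsQuadraticTransformAlong O (R i) (R (i + 1))) →
      ∀ (N : ℕ) [IsLocalRing (R N)] (s : ℕ) (z : Fin s → R N), IsRsopPart z →
      ∀ (g : K), g ∈ R N → ∀ (m : Fin s → ℕ), (∃ l, ¬ p ∣ m l) → ∀ (u : R N), IsUnit u →
      t ^ p - g ^ p = (∏ l, ((z l : R N) : K) ^ m l) * (u : K) →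
      ∃ (A : Subalgebra k K) (h : A.toSubring ≤ O.toSubring), A₀ ≤ A ∧ t ∈ A ∧ A.FG ∧
        IsFractionRing A K ∧ IsRegularLocalRing (Localization.AtPrime
          (Ideal.comap (Subring.inclusion h) (IsLocalRing.maximalIdeal O)))) :
    ∀ p : ℕ, p.Prime → ∀ (k K : Type) [Field k] [CharP k p] [Field K] [Algebra k K]
      (O : ValuationSubring K) (A₀ : Subalgebra k K) (h₀ : A₀.toSubring ≤ O.toSubring) (t : K),
      A₀.FG → t ^ p ∈ A₀ → IsFractionRing (Algebra.adjoin k (insert t (A₀ : Set K))) K →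
      IsRegularLocalRing (Localization.AtPrime
        (Ideal.comap (Subring.inclusion h₀) (IsLocalRing.maximalIdeal O))) →
      (∀ R : ℕ → Subring K, R 0 = locAtCentre A₀.toSubring O →
        (∀ i, IsQuadraticTransformAlong O (R i) (R (i + 1))) →
        ∀ x : K, x ∈ O → (∃ y ∈ A₀, ∃ z ∈ A₀, z ≠ 0 ∧ x = y / z) → ∃ i, x ∈ R i) →
      (∀ R : ℕ → Subring K, R 0 = locAtCentre A₀.toSubring O →
        (∀ i, IsQuadraticTransformAlong O (R i) (R (i + 1))) →
        ∀ y : K, (∃ a ∈ A₀, ∃ b ∈ A₀, b ≠ 0 ∧ y = a / b) → y ≠ 0 → O.valuation y < 1 →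
          ∃ (i : ℕ) (_ : IsLocalRing (R i)) (z : Fin 1 → R i), IsRsopPart z ∧
            ∃ n : ℕ, O.valuation ((z 0 : R i) : K) ^ n < O.valuation y) →
      ¬ (∀ g : K, (∃ a ∈ A₀, ∃ b ∈ A₀, b ≠ 0 ∧ g = a / b) →
        ∃ w : K, (∃ a ∈ A₀, ∃ b ∈ A₀, b ≠ 0 ∧ w = a / b) ∧
          O.valuation (t ^ p - g ^ p) = O.valuation (w ^ p)) →
      ∃ (A : Subalgebra k K) (h : A.toSubring ≤ O.toSubring), A₀ ≤ A ∧ t ∈ A ∧ A.FG ∧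
        IsFractionRing A K ∧ IsRegularLocalRing (Localization.AtPrime
          (Ideal.comap (Subring.inclusion h) (IsLocalRing.maximalIdeal O))) := by
  intro p hp k K _ _ _ _ O A₀ h₀ t hfg htp hfr hreg hSS hArch hnD
  classical
  haveI : Fact p.Prime := ⟨hp⟩
  haveI : CharP K p := charP_of_injective_algebraMap (algebraMap k K).injective p
  have hp0 : p ≠ 0 := hp.ne_zero
  -- fractions of `A₀` = the subfield `F` generated by `A₀`
  have hF := exists_div_iff_mem_closure A₀
  set F : Subfield K := Subfield.closure (A₀ : Set K) with hFdef
  have hA₀F : ∀ x ∈ A₀, x ∈ F := fun x hx => Subfield.subset_closure hx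
  have hA₀O : ∀ x ∈ A₀, x ∈ O := fun x hx => h₀ hx
  -- (1) the defectless witness `g`
  push Not at hnD
  obtain ⟨g, hgfrac, hgw⟩ := hnD
  have hgF : g ∈ F := (hF g).mp hgfrac
  -- (2) `t ∈ O` and `g ∈ O`
  have htO : t ∈ O := by
    by_contra h
    have h1 : 1 < O.valuation t := lt_of_not_ge fun h' => h ((O.valuation_le_one_iff t).mp h')
    have h2 : O.valuation (t ^ p) ≤ 1 := (O.valuation_le_one_iff _).mpr (hA₀O _ htp)
    rw [map_pow] at h2
    exact not_lt.mpr h2 (one_lt_pow₀ h1 hp0)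
  have hgO : g ∈ O := by
    by_contra h
    have h1 : O.valuation t < O.valuation g :=
      lt_of_le_of_lt ((O.valuation_le_one_iff t).mpr htO)
        (lt_of_not_ge fun h' => h ((O.valuation_le_one_iff g).mp h'))
    refine hgw g hgfrac ?_
    rw [← sub_pow_char t g, map_pow, map_pow, Valuation.map_sub_eq_of_lt_right _ h1]
  -- (3) the element `b := t ^ p - g ^ p`
  have hbF : t ^ p - g ^ p ∈ F := sub_mem (hA₀F _ htp) (pow_mem hgF p)
  have hbO : t ^ p - g ^ p ∈ O := sub_mem (hA₀O _ htp) (pow_mem hgO p)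
  generalize hb : t ^ p - g ^ p = b at hgw hbF hbO
  have hb0 : b ≠ 0 := by
    intro h
    refine hgw 0 ⟨0, A₀.zero_mem, 1, A₀.one_mem, one_ne_zero, (div_one 0).symm⟩ ?_
    rw [h, zero_pow hp0]
  have hvb1 : O.valuation b < 1 := by
    refine lt_of_le_of_ne ((O.valuation_le_one_iff b).mpr hbO) fun h => ?_
    refine hgw 1 ⟨1, A₀.one_mem, 1, A₀.one_mem, one_ne_zero, (div_one 1).symm⟩ ?_
    rw [h, one_pow, map_one]
  -- the centre of `O` on `A₀` is non-zero: the numerator `y` of `b`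
  obtain ⟨y, hyA, z', hz'A, hz'0, hbyz⟩ := (hF b).mpr hbF
  have hy0 : y ≠ 0 := by
    rintro rfl
    exact hb0 (by rw [hbyz, zero_div])
  have hvy : O.valuation y < 1 := by
    have hy : y = b * z' := by rw [hbyz, div_mul_cancel₀ _ hz'0]
    rw [hy, map_mul]
    calc O.valuation b * O.valuation z' ≤ O.valuation b * 1 :=
          mul_le_mul_right ((O.valuation_le_one_iff _).mpr (hA₀O _ hz'A)) _
      _ < 1 := by rw [mul_one]; exact hvb1
  -- (4) the quadratic sequence of the base along `O`
  obtain ⟨R, hR0, hstep, hRreg, hRdom, hRfrac⟩ := h₂ k K O A₀ h₀ hreg ⟨y, hyA, hy0, hvy⟩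
  haveI hRinst : ∀ i, IsRegularLocalRing (R i) := hRreg
  have hmono : Monotone R := sequence_monotone hstep
  have hRO : ∀ i, R i ≤ O.toSubring := fun i => (hRdom i).1
  have hA₀R : ∀ i, ∀ x ∈ A₀, x ∈ R i := fun i x hx =>
    hmono (Nat.zero_le i) (by rw [hR0]; exact le_locAtCentre A₀.toSubring O hx)
  -- (5) `g ∈ R i₀`; a regular parameter `x₀ := z₀ 0` of some `R i₁` with `v(x₀ ^ n) < v(b)`
  obtain ⟨i₀, hgi₀⟩ := hSS R hR0 hstep g hgO hgfrac
  obtain ⟨i₁, _, z₀, hz₀, n, hn⟩ := hArch R hR0 hstep b ((hF b).mpr hbF) hb0 hvb1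
  have hx₀frac := hRfrac i₁ _ (z₀ 0).2
  have hx₀F : ((z₀ 0 : R i₁) : K) ∈ F := (hF _).mp hx₀frac
  have hbase : ∃ (s : ℕ) (z : Fin s → R i₁), IsRsopPart z ∧ ∃ (e : Fin s → ℕ) (u : R i₁),
      IsUnit u ∧ ((z₀ 0 : R i₁) : K) = (∏ l, ((z l : R i₁) : K) ^ e l) * (u : K) :=
    ⟨1, z₀, hz₀, fun _ => 1, 1, isUnit_one, by simp⟩
  -- (7) `c := x₀ ^ n / b ∈ O ∩ Frac A₀` lies in some `R N₁`
  have hvc : O.valuation (((z₀ 0 : R i₁) : K) ^ n / b) < 1 := by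
    rw [map_div₀, map_pow, div_lt_one₀ ((Valuation.pos_iff _).mpr hb0)]
    exact hn
  have hcO : ((z₀ 0 : R i₁) : K) ^ n / b ∈ O := (O.valuation_le_one_iff _).mp hvc.le
  have hcF : ((z₀ 0 : R i₁) : K) ^ n / b ∈ F := div_mem (pow_mem hx₀F n) hbF
  obtain ⟨N₁, hcN₁⟩ := hSS R hR0 hstep _ hcO ((hF _).mpr hcF)
  -- (6) everything in `R N`, `N := i₁ + (N₁ + i₀)`, where `x₀` is a monomial times a unit
  obtain ⟨s, zN, hzN, eN, uN, huN, hx₀eq⟩ :=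
    exists_monomial_along h₁ O R hstep hRdom i₁ _ hbase (N₁ + i₀)
  have hcN : ((z₀ 0 : R i₁) : K) ^ n / b ∈ R (i₁ + (N₁ + i₀)) := hmono (by omega) hcN₁
  have hgN : g ∈ R (i₁ + (N₁ + i₀)) := hmono (by omega) hgi₀
  have hbN : b ∈ R (i₁ + (N₁ + i₀)) := by
    rw [← hb]
    exact sub_mem (hA₀R _ _ htp) (pow_mem hgN p)
  -- (8) `b · c = x₀ ^ n` is a monomial times a unit, hence so is `b`
  have hbc : b * (((z₀ 0 : R i₁) : K) ^ n / b) =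
      (∏ l, ((zN l : R (i₁ + (N₁ + i₀))) : K) ^ (n * eN l)) *
        ((uN ^ n : R (i₁ + (N₁ + i₀))) : K) := by
    rw [mul_div_cancel₀ _ hb0, hx₀eq, mul_pow, ← Finset.prod_pow, SubmonoidClass.coe_pow]
    refine congrArg (· * _) (Finset.prod_congr rfl fun l _ => ?_)
    rw [← pow_mul, mul_comm]
  obtain ⟨m, u', hu', hbm⟩ :=
    exists_monomial_of_mul_eq hzN (fun l => n * eN l) hbN hcN (huN.pow n) hbc
  -- (9) some exponent is prime to `p` (defectlessness)
  have hex : ∃ l, ¬ p ∣ m l := by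
    by_contra hall
    push Not at hall
    set w : R (i₁ + (N₁ + i₀)) := ∏ l, zN l ^ (m l / p) with hw
    have hwp : (w : K) ^ p = ∏ l, ((zN l : R (i₁ + (N₁ + i₀))) : K) ^ m l := by
      rw [hw]
      push_cast
      rw [← Finset.prod_pow]
      exact Finset.prod_congr rfl fun l _ => by rw [← pow_mul, Nat.div_mul_cancel (hall l)]
    refine hgw w (hRfrac _ _ w.2) ?_
    rw [hbm, ← hwp, map_mul, valuation_eq_one_of_isUnit_subring (hRO _) hu', mul_one]
  -- (10) exit
  exact h₃ p hp k K O A₀ h₀ t hfg htp hfr R hR0 hstep (i₁ + (N₁ + i₀)) s zN hzN g hgN m hex u' hu'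
    (hb.trans hbm)

end Summit.ResolutionOfSingularities.ResolutionOfSingularities.Theorems.SwitchingDichotomy
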